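import Literature.Topology.FourManifolds.DiscDiffeoIsotopy
import HarnessLib

/-!
# Self-isotopies standard off the model; the face step for the half-ball

Topic `Literature/Topology/FourManifolds` (programme of the fact
`Literature.Topology.FourManifolds.cerf_pi0DiffDisc_relBoundary_three`, brick C3 (E′): realising a germ along the flat face of the half-ball by
an isotopically trivial diffeomorphism — Cerf, Ch. IV §3, Propriété 3 / §5).

* `IsSelfIsotopy.exists_standard`: a self-isotopy `K` of a compact `M` whose initial stage has
  identity derivative along `M` (automatic for `M` the closure of an open set, e.g. a closed ball:
  `fderiv_zero_stage_closedBall`) may be replaced, without changing its values on `M`, by one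
  with `K₀ = id` everywhere and all stages equal to the identity off a prescribed neighbourhood
  of `M` (`K'_t = id + χ • (K_t - K₀)` with a cutoff `χ = 1` near `M`).

## References
* [CerfDiffeoSphere1968] J. Cerf, LNM 53 (1968), Ch. IV §3, Propriété 3; §5.
* [HirschDT1976] M. W. Hirsch, *Differential Topology*, GTM 33 (1976), Ch. 8 §1.
-/

noncomputable section

open Set Function Filter Topology Metric Real
open scoped ContDiff

namespace Literature.Topology.FourManifolds

namespace IsSelfIsotopy

variable {E : Type*} [NormedAddCommGroup E] [InnerProductSpace ℝ E] [FiniteDimensional ℝ E]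
  {M : Set E} {K : ℝ → E → E}

/-- **Standard form off the model.**  A self-isotopy of a compact `M` with `D(K₀) = I` along `M`
has a version with the same values on `M`, with `K'₀ = id` globally and `K'_t = id` outside
any given open `V ⊇ M`. [folklore] -/
theorem exists_standard (hM : IsCompact M) (h : IsSelfIsotopy M K)
    (hD0 : ∀ x ∈ M, fderiv ℝ (K 0) x = ContinuousLinearMap.id ℝ E) {V : Set E} (hV : IsOpen V)
    (hMV : M ⊆ V) :
    ∃ K' : ℝ → E → E, IsSelfIsotopy M K' ∧ (∀ t, ∀ x ∈ M, K' t x = K t x) ∧ (∀ x, K' 0 x = x) ∧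
      ∀ t x, x ∉ V → K' t x = x := by
  obtain ⟨χ, hχs, hχ1, hχ0⟩ := IsEmbGerm.exists_cutoff hM hV hMV
  set K' : ℝ → E → E := fun t x => x + χ x • (K t x - K 0 x) with hK'
  have h0 : ∀ x ∈ M, K 0 x = x := h.zero_apply
  have hval : ∀ t, ∀ x ∈ M, K' t x = K t x := fun t x hx => by
    have hχx : χ x = 1 := (hχ1.filter_mono (nhds_le_nhdsSet hx)).self_of_nhds
    simp only [hK', hχx, one_smul, h0 x hx]; abel
  have hsmooth : ContDiff ℝ ∞ (uncurry K') := by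
    have h1 : ContDiff ℝ ∞ fun q : ℝ × E => χ q.2 := hχs.comp contDiff_snd
    have h2 : ContDiff ℝ ∞ fun q : ℝ × E => K q.1 q.2 - K 0 q.2 :=
      h.contDiff.sub ((h.contDiff_stage 0).comp contDiff_snd)
    exact contDiff_snd.add (h1.smul h2)
  refine ⟨K', ⟨hsmooth, fun t ht => ⟨?_, fun x hx => ?_, fun x hx y hy hxy => ?_⟩, fun t ht => ?_,
    fun x _ => by simp [hK']⟩, hval, fun x => by simp [hK'], fun t x hx => ?_⟩
  · exact hsmooth.comp (contDiff_const.prodMk contDiff_id)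
  · -- near `x ∈ M` the stage is `y ↦ y + (K t y - K 0 y)`, with derivative `D(K t) x`
    have hev : K' t =ᶠ[𝓝 x] fun y => y + (K t y - K 0 y) := by
      filter_upwards [hχ1.filter_mono (nhds_le_nhdsSet hx)] with y hy
      simp only [hK', hy, one_smul]
    have hdt : HasFDerivAt (K t) (fderiv ℝ (K t) x) x :=
      ((h.contDiff_stage t).differentiable (by simp) x).hasFDerivAt
    have hd0 : HasFDerivAt (K 0) (ContinuousLinearMap.id ℝ E) x := by
      rw [← hD0 x hx]; exact ((h.contDiff_stage 0).differentiable (by simp) x).hasFDerivAt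
    have hd : HasFDerivAt (fun y => y + (K t y - K 0 y))
        (ContinuousLinearMap.id ℝ E + (fderiv ℝ (K t) x - ContinuousLinearMap.id ℝ E)) x :=
      (hasFDerivAt_id x).add (hdt.sub hd0)
    rw [hev.fderiv_eq, hd.fderiv, add_sub_cancel]
    exact (h.isEmbGerm t ht).isInvertible x hx
  · rw [hval t x hx, hval t y hy] at hxy
    exact (h.isEmbGerm t ht).injOn hx hy hxy
  · calc K' t '' M = K t '' M := image_congr fun x hx => hval t x hx
      _ = M := h.image_eq t ht
  · have hχx : χ x = 0 := (hχ0.filter_mono (nhds_le_nhdsSet (mem_compl hx))).self_of_nhds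
    simp [hK', hχx]

omit [FiniteDimensional ℝ E] in
/-- For the closed unit ball the initial stage of a self-isotopy has identity derivative along
the ball (it is the identity on the open ball, and the derivative is continuous). [folklore] -/
theorem fderiv_zero_stage_closedBall (h : IsSelfIsotopy (closedBall (0 : E) 1) K) {x : E}
    (hx : x ∈ closedBall (0 : E) 1) : fderiv ℝ (K 0) x = ContinuousLinearMap.id ℝ E := by
  have hcont : Continuous (fderiv ℝ (K 0)) := (h.contDiff_stage 0).continuous_fderiv (by simp)
  have hball : EqOn (fderiv ℝ (K 0)) (fun _ => ContinuousLinearMap.id ℝ E) (ball (0 : E) 1) := by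
    intro y hy
    have hev : K 0 =ᶠ[𝓝 y] id := by
      filter_upwards [isOpen_ball.mem_nhds hy] with z hz
      exact h.zero_apply z (ball_subset_closedBall hz)
    rw [hev.fderiv_eq, fderiv_id]
  have hcl := hball.closure hcont continuous_const
  rw [closure_ball (0 : E) one_ne_zero] at hcl
  exact hcl hx

/-- **Standard form for self-isotopies of the closed unit ball**: same values on the ball,
`K'₀ = id`, and `K'_t = id` off the ball of radius `2`. [folklore] -/
theorem exists_standard_closedBall (h : IsSelfIsotopy (closedBall (0 : E) 1) K) :
    ∃ K' : ℝ → E → E, IsSelfIsotopy (closedBall (0 : E) 1) K' ∧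
      (∀ t, ∀ x ∈ closedBall (0 : E) 1, K' t x = K t x) ∧ (∀ x, K' 0 x = x) ∧
      ∀ t x, 2 ≤ ‖x‖ → K' t x = x := by
  obtain ⟨K', hK', hval, h0, hout⟩ := h.exists_standard (isCompact_closedBall 0 1)
    (fun x hx => h.fderiv_zero_stage_closedBall hx) isOpen_ball
    (closedBall_subset_ball (by norm_num : (1 : ℝ) < 2))
  exact ⟨K', hK', hval, h0, fun t x hx => hout t x fun h' => by
    have := mem_ball_zero_iff.1 h'; linarith⟩

end IsSelfIsotopy

/-! ### Coordinates of `ℝ³ = ℝ² × ℝ` and the lower half-ball -/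

section HalfBall

/-- Local notation: `𝔼 n` is the model Euclidean space `EuclideanSpace ℝ (Fin n)`. -/
local notation "𝔼 " n:arg => EuclideanSpace ℝ (Fin n)
/-- Local notation: `𝔻 n` is the closed unit ball in `EuclideanSpace ℝ (Fin n)`. -/
local notation "𝔻 " n:arg => (Metric.closedBall (0 : EuclideanSpace ℝ (Fin n)) 1)

namespace HalfBall

/-- Horizontal part `(x₀, x₁)` of a point of `ℝ³`. [folklore] -/
def hor (x : 𝔼 3) : 𝔼 2 := !₂[x 0, x 1]

/-- The point `(u₀, u₁, z)` of `ℝ³`. [folklore] -/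
def mk (u : 𝔼 2) (z : ℝ) : 𝔼 3 := !₂[u 0, u 1, z]

/-- `hor_apply_zero` (hor apply zero). [folklore] -/
@[simp] theorem hor_apply_zero (x : 𝔼 3) : hor x 0 = x 0 := by simp [hor]
/-- `hor_apply_one` (hor apply one). [folklore] -/
@[simp] theorem hor_apply_one (x : 𝔼 3) : hor x 1 = x 1 := by simp [hor]
/-- `mk_apply_zero` (mk apply zero). [folklore] -/
@[simp] theorem mk_apply_zero (u : 𝔼 2) (z : ℝ) : mk u z 0 = u 0 := by simp [mk]
/-- `mk_apply_one` (mk apply one). [folklore] -/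
@[simp] theorem mk_apply_one (u : 𝔼 2) (z : ℝ) : mk u z 1 = u 1 := by simp [mk]
/-- `mk_apply_two` (mk apply two). [folklore] -/
@[simp] theorem mk_apply_two (u : 𝔼 2) (z : ℝ) : mk u z 2 = z := by simp [mk]

/-- `hor_mk` (hor mk). [folklore] -/
@[simp] theorem hor_mk (u : 𝔼 2) (z : ℝ) : hor (mk u z) = u := by
  ext i; fin_cases i <;> simp [hor, mk]

/-- `mk_hor` (mk hor). [folklore] -/
@[simp] theorem mk_hor (x : 𝔼 3) : mk (hor x) (x 2) = x := by
  ext i; fin_cases i <;> simp [hor, mk]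

/-- `mk_eq_mk_iff` (mk eq mk iff). [folklore] -/
theorem mk_eq_mk_iff {u v : 𝔼 2} {z w : ℝ} : mk u z = mk v w ↔ u = v ∧ z = w := by
  constructor
  · intro h
    refine ⟨?_, by simpa using congrFun (congrArg (fun p : 𝔼 3 => (p : Fin 3 → ℝ)) h) 2⟩
    have := congrArg hor h
    simpa using this
  · rintro ⟨rfl, rfl⟩; rfl

/-- `norm_sq_mk` (norm sq mk). [folklore] -/
theorem norm_sq_mk (u : 𝔼 2) (z : ℝ) : ‖mk u z‖ ^ 2 = ‖u‖ ^ 2 + z ^ 2 := by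
  rw [EuclideanSpace.norm_sq_eq, EuclideanSpace.norm_sq_eq, Fin.sum_univ_three, Fin.sum_univ_two]
  simp [mk]

/-- `norm_sq_eq_hor` (norm sq eq hor). [folklore] -/
theorem norm_sq_eq_hor (x : 𝔼 3) : ‖x‖ ^ 2 = ‖hor x‖ ^ 2 + (x 2) ^ 2 := by
  conv_lhs => rw [← mk_hor x]
  exact norm_sq_mk _ _

/-- `contDiff_hor` (contDiff hor). [folklore] -/
theorem contDiff_hor : ContDiff ℝ ∞ hor := by
  rw [contDiff_euclidean]
  intro i
  fin_cases i
  · simp only [hor, Fin.zero_eta, Fin.isValue, Matrix.cons_val_zero]; fun_prop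
  · simp only [hor, Fin.mk_one, Fin.isValue, Matrix.cons_val_one, Matrix.cons_val_zero]; fun_prop

/-- `contDiff_mk` (contDiff mk). [folklore] -/
theorem contDiff_mk : ContDiff ℝ ∞ (uncurry mk) := by
  rw [contDiff_euclidean]
  intro i
  fin_cases i
  · simp only [mk, uncurry, Fin.zero_eta, Fin.isValue, Matrix.cons_val_zero]; fun_prop
  · simp only [mk, uncurry, Fin.mk_one, Fin.isValue, Matrix.cons_val_one, Matrix.cons_val_zero]; fun_prop
  · simp only [mk, uncurry, Fin.reduceFinMk, Fin.isValue, Matrix.cons_val]; fun_prop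

/-- `ContDiff.mk'` (ContDiff.mk'). [folklore] -/
theorem ContDiff.mk' {X : Type*} [NormedAddCommGroup X] [NormedSpace ℝ X] {f : X → 𝔼 2} {g : X → ℝ}
    (hf : ContDiff ℝ ∞ f) (hg : ContDiff ℝ ∞ g) : ContDiff ℝ ∞ fun x => mk (f x) (g x) :=
  contDiff_mk.comp (hf.prodMk hg)

/-- The lower half-ball `M⁻ = 𝔻³ ∩ {z ≤ 0}`. [cite: CerfDiffeoSphere1968, Ch. III §2 (model M₁)] -/
def lowerHalfBall : Set (𝔼 3) := closedBall (0 : 𝔼 3) 1 ∩ {x | x 2 ≤ 0}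

/-- `mem_lowerHalfBall_iff` (mem lowerHalfBall iff). [folklore] -/
theorem mem_lowerHalfBall_iff {x : 𝔼 3} : x ∈ lowerHalfBall ↔ ‖x‖ ≤ 1 ∧ x 2 ≤ 0 := by
  simp [lowerHalfBall]

/-- `isCompact_lowerHalfBall` (isCompact lowerHalfBall). [folklore] -/
theorem isCompact_lowerHalfBall : IsCompact lowerHalfBall :=
  (isCompact_closedBall 0 1).inter_right (isClosed_le (EuclideanSpace.proj (2 : Fin 3)).continuous continuous_const)

/-- Membership in `M⁻` in the coordinates `(u, z)`: `‖u‖² + z² ≤ 1` and `z ≤ 0`. [folklore] -/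
theorem mk_mem_lowerHalfBall_iff {u : 𝔼 2} {z : ℝ} :
    mk u z ∈ lowerHalfBall ↔ ‖u‖ ^ 2 + z ^ 2 ≤ 1 ∧ z ≤ 0 := by
  rw [mem_lowerHalfBall_iff, mk_apply_two, ← norm_sq_mk]
  constructor
  · rintro ⟨h1, h2⟩; exact ⟨by nlinarith [norm_nonneg (mk u z)], h2⟩
  · rintro ⟨h1, h2⟩
    exact ⟨by nlinarith [norm_nonneg (mk u z)], h2⟩

/-! ### The conical product extension of a self-isotopy of the face disc -/

/-- The radius `w(z) = √(1 - z²)` of the level disc of the ball at height `z`. [folklore] -/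
def lvl (z : ℝ) : ℝ := Real.sqrt (1 - z ^ 2)

/-- `lvl_pos` (lvl pos). [folklore] -/
theorem lvl_pos {z : ℝ} (hz : |z| < 1 / 2) : 0 < lvl z := by
  have : z ^ 2 < 1 := by have := abs_lt.1 hz; nlinarith
  exact Real.sqrt_pos.2 (by linarith)

/-- `lvl_sq` (lvl sq). [folklore] -/
theorem lvl_sq {z : ℝ} (hz : |z| < 1 / 2) : lvl z ^ 2 = 1 - z ^ 2 := by
  have : z ^ 2 < 1 := by have := abs_lt.1 hz; nlinarith
  exact Real.sq_sqrt (by linarith)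

/-- `lvl_zero` (lvl zero). [folklore] -/
theorem lvl_zero : lvl 0 = 1 := by simp [lvl]

/-- `contDiffAt_lvl` (contDiffAt lvl). [folklore] -/
theorem contDiffAt_lvl {z : ℝ} (hz : |z| < 1 / 2) : ContDiffAt ℝ ∞ lvl z := by
  have : z ^ 2 < 1 := by have := abs_lt.1 hz; nlinarith
  exact (contDiffAt_const.sub (contDiffAt_id.pow 2)).sqrt (by simp only [id_eq]; linarith)

/-- The vertical taper `β(z) = σ(2 - 32 z²)`: `β = 1` for `z² ≤ 1/32`, `β = 0` for `|z| ≥ 1/4`,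
`β ∈ [0, 1]`. [folklore] -/
def taper (z : ℝ) : ℝ := smoothTransition (2 - 32 * z ^ 2)

/-- `taper_mem_Icc` (taper mem Icc). [folklore] -/
theorem taper_mem_Icc (z : ℝ) : taper z ∈ Icc (0 : ℝ) 1 :=
  ⟨smoothTransition.nonneg _, smoothTransition.le_one _⟩

/-- `taper_eq_one` (taper eq one). [folklore] -/
theorem taper_eq_one {z : ℝ} (hz : z ^ 2 ≤ 1 / 32) : taper z = 1 :=
  smoothTransition.one_of_one_le (by linarith)

/-- `taper_zero` (taper zero). [folklore] -/
theorem taper_zero : taper 0 = 1 := taper_eq_one (by norm_num)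

/-- `taper_eq_zero` (taper eq zero). [folklore] -/
theorem taper_eq_zero {z : ℝ} (hz : 1 / 4 ≤ |z|) : taper z = 0 := by
  apply smoothTransition.zero_of_nonpos
  have : 1 / 16 ≤ z ^ 2 := by
    have h := sq_abs z; nlinarith [abs_nonneg z]
  linarith

/-- `contDiff_taper` (contDiff taper). [folklore] -/
theorem contDiff_taper : ContDiff ℝ ∞ taper :=
  smoothTransition.contDiff.comp (contDiff_const.sub (contDiff_const.mul (contDiff_id.pow 2)))

variable (K : ℝ → 𝔼 2 → 𝔼 2)

/-- **The conical product extension** of a family `K` of self-maps of the plane: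
`P_t (w(z) u, z) = (w(z) K_{β(z) t} u, z)` for `|z| < 1/2`, the identity elsewhere. [folklore] -/
def coneExt (t : ℝ) (x : 𝔼 3) : 𝔼 3 :=
  if |x 2| < 1 / 2 then mk (lvl (x 2) • K (taper (x 2) * t) ((lvl (x 2))⁻¹ • hor x)) (x 2) else x

variable {K}

/-- `coneExt_of_lt` (coneExt of lt). [folklore] -/
theorem coneExt_of_lt {t : ℝ} {x : 𝔼 3} (hx : |x 2| < 1 / 2) :
    coneExt K t x = mk (lvl (x 2) • K (taper (x 2) * t) ((lvl (x 2))⁻¹ • hor x)) (x 2) := by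
  rw [coneExt, if_pos hx]

/-- `coneExt_apply_two` (coneExt apply two). [folklore] -/
theorem coneExt_apply_two (t : ℝ) (x : 𝔼 3) : coneExt K t x 2 = x 2 := by
  unfold coneExt; split_ifs <;> simp

/-- Where the taper vanishes (`|z| ≥ 1/4`) the extension is the identity, provided `K₀ = id`.
[folklore] -/
theorem coneExt_eq_self (h0 : ∀ u, K 0 u = u) {t : ℝ} {x : 𝔼 3} (hx : 1 / 4 ≤ |x 2|) :
    coneExt K t x = x := by
  unfold coneExt
  split_ifs with h
  · rw [taper_eq_zero hx, zero_mul, h0, smul_smul, mul_inv_cancel₀ (lvl_pos h).ne', one_smul, mk_hor]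
  · rfl

/-- On the face disc: `P_t (u, 0) = (K_t u, 0)`. [folklore] -/
theorem coneExt_mk_zero (t : ℝ) (u : 𝔼 2) : coneExt K t (mk u 0) = mk (K t u) 0 := by
  rw [coneExt_of_lt (by simp)]
  simp [lvl_zero, taper_zero]

/-- At time `0` the extension is the identity (if `K₀ = id`). [folklore] -/
theorem coneExt_zero (h0 : ∀ u, K 0 u = u) (x : 𝔼 3) : coneExt K 0 x = x := by
  unfold coneExt
  split_ifs with h
  · rw [mul_zero, h0, smul_smul, mul_inv_cancel₀ (lvl_pos h).ne', one_smul, mk_hor]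
  · rfl

/-- The conical formula is smooth in `(t, x)` at points with `|z| < 1/2`, for any jointly smooth
family. [folklore] -/
theorem contDiffAt_cone_formula (hK : ContDiff ℝ ∞ (uncurry K)) {t : ℝ} {x : 𝔼 3}
    (hx : |x 2| < 1 / 2) :
    ContDiffAt ℝ ∞ (fun q : ℝ × 𝔼 3 =>
      mk (lvl (q.2 2) • K (taper (q.2 2) * q.1) ((lvl (q.2 2))⁻¹ • hor q.2)) (q.2 2)) (t, x) := by
    have hz : ContDiffAt ℝ ∞ (fun q : ℝ × 𝔼 3 => q.2 2) (t, x) := by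
      have h : ContDiff ℝ ∞ (fun q : ℝ × 𝔼 3 => q.2 2) := by fun_prop
      exact h.contDiffAt
    have hl : ContDiffAt ℝ ∞ (fun q : ℝ × 𝔼 3 => lvl (q.2 2)) (t, x) :=
      ContDiffAt.comp (f := fun q : ℝ × 𝔼 3 => q.2 2) (g := lvl) (t, x) (contDiffAt_lvl hx) hz
    have hli : ContDiffAt ℝ ∞ (fun q : ℝ × 𝔼 3 => (lvl (q.2 2))⁻¹) (t, x) := hl.inv (lvl_pos hx).ne'
    have hs : ContDiffAt ℝ ∞ (fun q : ℝ × 𝔼 3 => taper (q.2 2) * q.1) (t, x) :=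
      (contDiff_taper.contDiffAt.comp (t, x) hz).mul contDiffAt_fst
    have hu : ContDiffAt ℝ ∞ (fun q : ℝ × 𝔼 3 => (lvl (q.2 2))⁻¹ • hor q.2) (t, x) :=
      hli.smul (contDiff_hor.comp contDiff_snd).contDiffAt
    have hKc : ContDiffAt ℝ ∞ (fun q : ℝ × 𝔼 3 => K (taper (q.2 2) * q.1) ((lvl (q.2 2))⁻¹ • hor q.2))
        (t, x) := hK.contDiffAt.comp (t, x) (hs.prodMk hu)
    exact contDiff_mk.contDiffAt.comp (t, x) ((hl.smul hKc).prodMk hz)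

/-- The stage formula is smooth at points with `|z| < 1/2`. [folklore] -/
theorem contDiffAt_coneExt_of_lt (hK : ContDiff ℝ ∞ (uncurry K)) (t : ℝ) {x : 𝔼 3}
    (hx : |x 2| < 1 / 2) : ContDiffAt ℝ ∞ (coneExt K t) x := by
  have hopen : IsOpen {y : 𝔼 3 | |y 2| < 1 / 2} :=
    isOpen_lt (continuous_abs.comp (EuclideanSpace.proj (2 : Fin 3)).continuous) continuous_const
  have hev : coneExt K t =ᶠ[𝓝 x] fun y : 𝔼 3 =>
      mk (lvl (y 2) • K (taper (y 2) * t) ((lvl (y 2))⁻¹ • hor y)) (y 2) := by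
    filter_upwards [hopen.mem_nhds hx] with y hy
    exact coneExt_of_lt hy
  refine ContDiffAt.congr_of_eventuallyEq ?_ hev
  exact (contDiffAt_cone_formula hK hx).comp x (contDiffAt_const.prodMk contDiffAt_id)

/-- **Joint smoothness of the conical extension** (for `K` jointly smooth with `K₀ = id`).
[folklore] -/
theorem contDiff_coneExt (hK : ContDiff ℝ ∞ (uncurry K)) (h0 : ∀ u, K 0 u = u) :
    ContDiff ℝ ∞ (uncurry (coneExt K)) := by
  refine contDiff_iff_contDiffAt.2 fun q => ?_
  obtain ⟨t, x⟩ := q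
  by_cases hx : |x 2| < 1 / 2
  · -- the conical formula, smooth near `(t, x)`
    have hopen : IsOpen {q : ℝ × 𝔼 3 | |q.2 2| < 1 / 2} :=
      isOpen_lt (continuous_abs.comp ((EuclideanSpace.proj (2 : Fin 3)).continuous.comp continuous_snd))
        continuous_const
    have hev : uncurry (coneExt K) =ᶠ[𝓝 (t, x)] fun q : ℝ × 𝔼 3 =>
        mk (lvl (q.2 2) • K (taper (q.2 2) * q.1) ((lvl (q.2 2))⁻¹ • hor q.2)) (q.2 2) := by
      filter_upwards [hopen.mem_nhds hx] with q hq
      exact coneExt_of_lt hq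
    exact (contDiffAt_cone_formula hK hx).congr_of_eventuallyEq hev
  · -- identity near `(t, x)` (`|z| > 1/4` there)
    have hx' : 1 / 4 < |x 2| := by linarith [not_lt.1 hx]
    have hopen : IsOpen {q : ℝ × 𝔼 3 | 1 / 4 < |q.2 2|} :=
      isOpen_lt continuous_const
        (continuous_abs.comp ((EuclideanSpace.proj (2 : Fin 3)).continuous.comp continuous_snd))
    have hev : uncurry (coneExt K) =ᶠ[𝓝 (t, x)] fun q : ℝ × 𝔼 3 => q.2 := by
      filter_upwards [hopen.mem_nhds hx'] with q hq
      exact coneExt_eq_self h0 hq.le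
    exact contDiffAt_snd.congr_of_eventuallyEq hev


/-! ### The conical extension of a standard self-isotopy of the disc is a self-isotopy of `M⁻` -/

section SelfIsotopy

/-- Scaled horizontal part of a point of `M⁻` with `|z| < 1/2` lies in the unit disc. [folklore] -/
theorem scaled_hor_mem {x : 𝔼 3} (hx : x ∈ lowerHalfBall) (hz : |x 2| < 1 / 2) :
    (lvl (x 2))⁻¹ • hor x ∈ (𝔻 2) := by
  have hl := lvl_pos hz
  have h1 : ‖hor x‖ ^ 2 ≤ lvl (x 2) ^ 2 := by
    rw [lvl_sq hz]
    have := norm_sq_eq_hor x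
    have h2 : ‖x‖ ^ 2 ≤ 1 := by
      have := (mem_lowerHalfBall_iff.1 hx).1; nlinarith [norm_nonneg x]
    linarith
  have h2 : ‖hor x‖ ≤ lvl (x 2) := by
    nlinarith [norm_nonneg (hor x), hl]
  rw [mem_closedBall_zero_iff, norm_smul, norm_inv, Real.norm_of_nonneg hl.le]
  rw [inv_mul_le_iff₀ hl]; linarith

/-- A point `(w(z) v, z)` with `v ∈ 𝔻²`, `|z| < 1/2`, `z ≤ 0` lies in `M⁻`. [folklore] -/
theorem mk_smul_mem {v : 𝔼 2} (hv : v ∈ (𝔻 2)) {z : ℝ} (hz : |z| < 1 / 2) (hz0 : z ≤ 0) :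
    mk (lvl z • v) z ∈ lowerHalfBall := by
  rw [mk_mem_lowerHalfBall_iff, norm_smul, Real.norm_of_nonneg (lvl_pos hz).le, mul_pow, lvl_sq hz]
  refine ⟨?_, hz0⟩
  have h1 : ‖v‖ ^ 2 ≤ 1 := by
    have := mem_closedBall_zero_iff.1 hv; nlinarith [norm_nonneg v]
  have h2 : 0 ≤ 1 - z ^ 2 := by have := abs_lt.1 hz; nlinarith
  nlinarith

/-- Stages of the conical extension map `M⁻` into `M⁻`. [folklore] -/
theorem coneExt_mem (hS : IsSelfIsotopy (𝔻 2) K) {t : ℝ} (ht : t ∈ Icc (0 : ℝ) 1) {x : 𝔼 3}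
    (hx : x ∈ lowerHalfBall) :
    coneExt K t x ∈ lowerHalfBall := by
  by_cases hz : |x 2| < 1 / 2
  · rw [coneExt_of_lt hz]
    have hs : taper (x 2) * t ∈ Icc (0 : ℝ) 1 :=
      ⟨mul_nonneg (taper_mem_Icc _).1 ht.1, mul_le_one₀ (taper_mem_Icc _).2 ht.1 ht.2⟩
    exact mk_smul_mem (hS.mapsTo hs (scaled_hor_mem hx hz)) hz (mem_lowerHalfBall_iff.1 hx).2
  · rw [coneExt, if_neg hz]; exact hx

/-- Stages of the conical extension map `M⁻` onto `M⁻`. [folklore] -/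
theorem image_coneExt (hS : IsSelfIsotopy (𝔻 2) K) {t : ℝ} (ht : t ∈ Icc (0 : ℝ) 1) :
    coneExt K t '' lowerHalfBall = lowerHalfBall := by
  refine Subset.antisymm ?_ fun y hy => ?_
  · rintro _ ⟨x, hx, rfl⟩; exact coneExt_mem hS ht hx
  · by_cases hz : |y 2| < 1 / 2
    · have hs : taper (y 2) * t ∈ Icc (0 : ℝ) 1 :=
        ⟨mul_nonneg (taper_mem_Icc _).1 ht.1, mul_le_one₀ (taper_mem_Icc _).2 ht.1 ht.2⟩
      have hv := scaled_hor_mem hy hz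
      obtain ⟨u, hu, huv⟩ : (lvl (y 2))⁻¹ • hor y ∈ K (taper (y 2) * t) '' (𝔻 2) := by
        rw [hS.image_eq _ hs]; exact hv
      refine ⟨mk (lvl (y 2) • u) (y 2), mk_smul_mem hu hz (mem_lowerHalfBall_iff.1 hy).2, ?_⟩
      have hl := (lvl_pos hz).ne'
      rw [coneExt_of_lt (by simpa using hz)]
      simp only [mk_apply_two, hor_mk, smul_smul, inv_mul_cancel₀ hl, one_smul, huv,
        mul_inv_cancel₀ hl, mk_hor]
    · exact ⟨y, hy, by rw [coneExt, if_neg hz]⟩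

/-- Stages of the conical extension are injective on `M⁻`. [folklore] -/
theorem injOn_coneExt (hS : IsSelfIsotopy (𝔻 2) K) {t : ℝ} (ht : t ∈ Icc (0 : ℝ) 1) :
    InjOn (coneExt K t) lowerHalfBall := by
  intro x hx y hy hxy
  have hz : x 2 = y 2 := by
    have := congrArg (fun p : 𝔼 3 => p 2) hxy
    simpa [coneExt_apply_two] using this
  by_cases hzx : |x 2| < 1 / 2
  · have hzy : |y 2| < 1 / 2 := hz ▸ hzx
    rw [coneExt_of_lt hzx, coneExt_of_lt hzy, mk_eq_mk_iff] at hxy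
    have hl := (lvl_pos hzx).ne'
    have h1 : K (taper (x 2) * t) ((lvl (x 2))⁻¹ • hor x) =
        K (taper (x 2) * t) ((lvl (x 2))⁻¹ • hor y) := by
      have := hxy.1
      rw [← hz] at this
      exact smul_right_injective _ hl this
    have hs : taper (x 2) * t ∈ Icc (0 : ℝ) 1 :=
      ⟨mul_nonneg (taper_mem_Icc _).1 ht.1, mul_le_one₀ (taper_mem_Icc _).2 ht.1 ht.2⟩
    have h2 := (hS.isEmbGerm _ hs).injOn (scaled_hor_mem hx hzx) (hz ▸ scaled_hor_mem hy hzy :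
      (lvl (x 2))⁻¹ • hor y ∈ (𝔻 2)) h1
    have h3 : hor x = hor y := smul_right_injective _ (inv_ne_zero hl) h2
    rw [← mk_hor x, ← mk_hor y, h3, hz]
  · have hzy : ¬ |y 2| < 1 / 2 := hz ▸ hzx
    rwa [coneExt, if_neg hzx, coneExt, if_neg hzy] at hxy

/-- **The conical extension of a standard self-isotopy of the disc is a self-isotopy of the
lower half-ball.** [folklore] -/
theorem isSelfIsotopy_coneExt (hS : IsSelfIsotopy (𝔻 2) K) (h0 : ∀ u, K 0 u = u) :
    IsSelfIsotopy lowerHalfBall (coneExt K) := by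
  haveI : CompleteSpace (𝔼 2) := FiniteDimensional.complete ℝ _
  -- an inverse family of `K` near `[0, 1] × 𝔻²`
  obtain ⟨G, hGs, hleft, -, -⟩ := IsEmbGerm.exists_inverse_family isCompact_Icc
    (isCompact_closedBall (0 : 𝔼 2) 1) hS.contDiff
    (fun t ht x hx => (hS.isEmbGerm t ht).isInvertible x hx) (fun t ht => (hS.isEmbGerm t ht).injOn)
  refine ⟨contDiff_coneExt hS.contDiff h0, fun t ht => ⟨?_, fun x hx => ?_, injOn_coneExt hS ht⟩,
    fun t ht => image_coneExt hS ht, fun x _ => coneExt_zero h0 x⟩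
  · exact (contDiff_coneExt hS.contDiff h0).comp (contDiff_const.prodMk contDiff_id)
  · by_cases hz : 1 / 4 < |x 2|
    · -- identity near `x`
      have hev : coneExt K t =ᶠ[𝓝 x] id := by
        filter_upwards [(isOpen_lt continuous_const
          (continuous_abs.comp (EuclideanSpace.proj (2 : Fin 3)).continuous)).mem_nhds hz] with y hy
        exact coneExt_eq_self h0 hy.le
      rw [hev.fderiv_eq, fderiv_id]
      exact ⟨ContinuousLinearEquiv.refl ℝ _, rfl⟩
    · have hz' : |x 2| < 1 / 2 := by linarith [not_lt.1 hz]
      -- the local inverse `Q = coneExt G t` : `Q (coneExt K t y) = y` near `x`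
      set s : ℝ := taper (x 2) * t with hsdef
      have hs : s ∈ Icc (0 : ℝ) 1 :=
        ⟨mul_nonneg (taper_mem_Icc _).1 ht.1, mul_le_one₀ (taper_mem_Icc _).2 ht.1 ht.2⟩
      have hu := scaled_hor_mem hx hz'
      obtain ⟨W, hW, hWsub⟩ : ∃ W : Set (ℝ × 𝔼 2), IsOpen W ∧ ((s, (lvl (x 2))⁻¹ • hor x) ∈ W) ∧
          ∀ q ∈ W, G q.1 (K q.1 q.2) = q.2 := by
        obtain ⟨W, hWo, hsubW, hW⟩ := mem_nhdsSet_iff_exists.1 hleft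
        exact ⟨W, hWo, hsubW ⟨hs, hu⟩, fun q hq => hW hq⟩
      obtain ⟨hWx, hWall⟩ := hWsub
      -- continuity of `y ↦ (taper (y 2) t, scaled horizontal part)` at `x`
      have hcont : ContinuousAt (fun y : 𝔼 3 => ((taper (y 2) * t, (lvl (y 2))⁻¹ • hor y) : ℝ × 𝔼 2)) x := by
        have h1 : Continuous (fun y : 𝔼 3 => y 2) := by fun_prop
        have h2 : ContinuousAt (fun y : 𝔼 3 => taper (y 2) * t) x :=
          ((contDiff_taper.continuous.comp h1).mul continuous_const).continuousAt
        have h3 : ContinuousAt (fun y : 𝔼 3 => lvl (y 2)) x :=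
          ContinuousAt.comp (f := fun y : 𝔼 3 => y 2) (g := lvl) (x := x)
            (contDiffAt_lvl hz').continuousAt h1.continuousAt
        exact h2.prodMk ((h3.inv₀ (lvl_pos hz').ne').smul contDiff_hor.continuous.continuousAt)
      have hev : (coneExt G t ∘ coneExt K t) =ᶠ[𝓝 x] id := by
        show ∀ᶠ y in 𝓝 x, (coneExt G t ∘ coneExt K t) y = id y
        simp only [comp_apply, id_eq]
        have hopen : IsOpen {y : 𝔼 3 | |y 2| < 1 / 2} :=
          isOpen_lt (continuous_abs.comp (EuclideanSpace.proj (2 : Fin 3)).continuous) continuous_const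
        filter_upwards [hcont.preimage_mem_nhds (hW.mem_nhds hWx), hopen.mem_nhds hz'] with y hyW hy
        have hl := (lvl_pos hy).ne'
        rw [coneExt_of_lt hy, coneExt_of_lt (by simpa using hy)]
        simp only [mk_apply_two, hor_mk, smul_smul, inv_mul_cancel₀ hl, one_smul]
        rw [hWall _ hyW, smul_smul, mul_inv_cancel₀ hl, one_smul, mk_hor]
      -- differentiate `Q ∘ P = id` at `x`
      have hPd : DifferentiableAt ℝ (coneExt K t) x :=
        (contDiffAt_coneExt_of_lt hS.contDiff t hz').differentiableAt (by simp)
      have hQd : DifferentiableAt ℝ (coneExt G t) (coneExt K t x) :=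
        (contDiffAt_coneExt_of_lt hGs t (by simpa [coneExt_apply_two] using hz')).differentiableAt
          (by simp)
      have hcomp : (fderiv ℝ (coneExt G t) (coneExt K t x)).comp (fderiv ℝ (coneExt K t) x) =
          ContinuousLinearMap.id ℝ (𝔼 3) := by
        rw [← fderiv_comp x hQd hPd, hev.fderiv_eq, fderiv_id]
      apply CollarNormalisation.isInvertible_of_injective
      intro v w hvw
      have := congrArg (fderiv ℝ (coneExt G t) (coneExt K t x)) hvw
      have h1 := congrArg (fun L : 𝔼 3 →L[ℝ] 𝔼 3 => L v) hcomp
      have h2 := congrArg (fun L : 𝔼 3 →L[ℝ] 𝔼 3 => L w) hcomp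
      simp only [ContinuousLinearMap.coe_comp, comp_apply, ContinuousLinearMap.id_apply] at h1 h2
      rw [← h1, ← h2, this]

/-- **Stages of the conical extension preserve the unit sphere within `M⁻`**: for
`x ∈ M⁻`, `‖P_t x‖ = 1 ↔ ‖x‖ = 1` (the disc isotopy preserves the unit circle). [folklore] -/
theorem norm_coneExt_eq_one_iff (hS : IsSelfIsotopy (𝔻 2) K) {t : ℝ} (ht : t ∈ Icc (0 : ℝ) 1)
    {x : 𝔼 3} (hx : x ∈ lowerHalfBall) : ‖coneExt K t x‖ = 1 ↔ ‖x‖ = 1 := by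
  by_cases hz : |x 2| < 1 / 2
  · have hs : taper (x 2) * t ∈ Icc (0 : ℝ) 1 :=
      ⟨mul_nonneg (taper_mem_Icc _).1 ht.1, mul_le_one₀ (taper_mem_Icc _).2 ht.1 ht.2⟩
    have hl := lvl_pos hz
    have hu := scaled_hor_mem hx hz
    have himg := (hS.isEmbGerm _ hs).image_sphere_eq (hS.image_eq _ hs)
    -- `‖K_s u‖ = 1 ↔ ‖u‖ = 1`
    have hK : ‖K (taper (x 2) * t) ((lvl (x 2))⁻¹ • hor x)‖ = 1 ↔ ‖(lvl (x 2))⁻¹ • hor x‖ = 1 := by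
      constructor
      · intro h
        have : K (taper (x 2) * t) ((lvl (x 2))⁻¹ • hor x) ∈ K (taper (x 2) * t) '' sphere (0 : 𝔼 2) 1 := by
          rw [himg]; exact mem_sphere_zero_iff_norm.2 h
        obtain ⟨u', hu', heq⟩ := this
        have := (hS.isEmbGerm _ hs).injOn (sphere_subset_closedBall hu') hu heq
        rw [← this]; exact mem_sphere_zero_iff_norm.1 hu'
      · intro h
        have : K (taper (x 2) * t) ((lvl (x 2))⁻¹ • hor x) ∈ K (taper (x 2) * t) '' sphere (0 : 𝔼 2) 1 :=
          mem_image_of_mem _ (mem_sphere_zero_iff_norm.2 h)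
        rw [himg] at this; exact mem_sphere_zero_iff_norm.1 this
    -- norms in terms of the scaled horizontal part
    have hn1 : ‖coneExt K t x‖ ^ 2 = lvl (x 2) ^ 2 * ‖K (taper (x 2) * t) ((lvl (x 2))⁻¹ • hor x)‖ ^ 2 + (x 2) ^ 2 := by
      rw [coneExt_of_lt hz, norm_sq_mk, norm_smul, Real.norm_of_nonneg hl.le]; ring
    have hn2 : ‖x‖ ^ 2 = lvl (x 2) ^ 2 * ‖(lvl (x 2))⁻¹ • hor x‖ ^ 2 + (x 2) ^ 2 := by
      rw [norm_sq_eq_hor x, norm_smul, norm_inv, Real.norm_of_nonneg hl.le]; field_simp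
    have hlsq := lvl_sq hz
    have key : ∀ (a : ℝ), 0 ≤ a → (lvl (x 2) ^ 2 * a ^ 2 + (x 2) ^ 2 = 1 ↔ a = 1) := fun a ha => by
      rw [hlsq]
      constructor
      · intro h
        have h1 : (1 - (x 2) ^ 2) * (a ^ 2 - 1) = 0 := by linarith
        have h2 : 1 - (x 2) ^ 2 ≠ 0 := by rw [← hlsq]; exact (pow_pos hl 2).ne'
        have h3 : a ^ 2 = 1 := by
          have := mul_eq_zero.1 h1; rcases this with h | h
          · exact absurd h h2
          · linarith
        nlinarith
      · intro h; rw [h]; ring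
    have e1 : ‖coneExt K t x‖ = 1 ↔ ‖K (taper (x 2) * t) ((lvl (x 2))⁻¹ • hor x)‖ = 1 := by
      rw [← key (‖K (taper (x 2) * t) ((lvl (x 2))⁻¹ • hor x)‖) (norm_nonneg _), ← hn1]
      constructor
      · intro h; rw [h, one_pow]
      · intro h; nlinarith [norm_nonneg (coneExt K t x)]
    have e2 : ‖x‖ = 1 ↔ ‖(lvl (x 2))⁻¹ • hor x‖ = 1 := by
      rw [← key (‖(lvl (x 2))⁻¹ • hor x‖) (norm_nonneg _), ← hn2]
      constructor
      · intro h; rw [h, one_pow]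
      · intro h; nlinarith [norm_nonneg x]
    rw [e1, hK, ← e2]
  · rw [coneExt, if_neg hz]

end SelfIsotopy

/-! ### The face step -/

/-- **Face step.**  Every orientation-preserving embedding germ `d` of the closed unit disc onto
itself is realised on the flat face `D₀ = 𝔻² × {0}` of the lower half-ball `M⁻` by the end of
a self-isotopy `P` of `M⁻` which preserves heights: `P₁ (u, 0) = (d u, 0)` for `u ∈ 𝔻²`.
[cite: CerfDiffeoSphere1968, Ch. IV §3, Propriété 3] -/
theorem exists_selfIsotopy_face {d : 𝔼 2 → 𝔼 2} (hd : IsEmbGerm (𝔻 2) d)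
    (himg : d '' (𝔻 2) = 𝔻 2)
    (hdet : ∀ x ∈ 𝔻 2, 0 < LinearMap.det (fderiv ℝ d x : 𝔼 2 →ₗ[ℝ] 𝔼 2)) :
    ∃ P : ℝ → 𝔼 3 → 𝔼 3, IsSelfIsotopy lowerHalfBall P ∧
      (∀ u ∈ 𝔻 2, P 1 (mk u 0) = mk (d u) 0) ∧ (∀ t x, P t x 2 = x 2) ∧
      (∀ t u, ∃ v, P t (mk u 0) = mk v 0) ∧
      ∀ t ∈ Icc (0 : ℝ) 1, ∀ x ∈ lowerHalfBall, ‖P t x‖ = 1 ↔ ‖x‖ = 1 := by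
  obtain ⟨K, hK, hK1⟩ := DiscDiffeoIsotopy.isoRel_id_of_germ hd himg hdet
  obtain ⟨K', hK', hval, h0, -⟩ := hK.exists_standard_closedBall
  refine ⟨coneExt K', isSelfIsotopy_coneExt hK' h0, fun u hu => ?_, fun t x => coneExt_apply_two t x,
    fun t u => ⟨K' t u, coneExt_mk_zero t u⟩, fun t ht x hx => norm_coneExt_eq_one_iff hK' ht hx⟩
  rw [coneExt_mk_zero, hval 1 u hu, hK1 u hu, id]


end HalfBall

end HalfBall

end Literature.Topology.FourManifolds
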